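import Summits.QuantumFields.YangMills.Theorems.UnitScaleTiltProp7CurrentFieldLeibniz
import HarnessLib

/-!
# Route `UnitScaleTilt`, crux K1 «MinimiserStabilityRegPr» (stmt-QuantumFields-19200), route-R E′ growth side, ℛ-line, J-ROW★ curved — brick B-J2, TORUS-SUMMED AND CURL FORM:
# `Σ_xΣ_μΣ_κ|(D_κ C_μ)(x) + MAIN_{κμ}(x)|²_HS ≤ 8d²J²·(d·M(φ) + 2K(φ))` and, for the test field `B := C` of ✓ `current_pairing_le`,
# `Σ_{x,μ<κ}|curl_U C_{μκ}|²_HS ≤ 2·Σ_{x,μ<κ}|MAIN_{κμ} − MAIN_{μκ}|²_HS + 32d²J²·(d·M(φ) + 2K(φ))` — the curl energy of the current field is ONE principal difference (B-J3's input) plus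
# errors in the E′ currencies `M`, `K` (✓p684887's letters VERBATIM)

Cell `ym3-torus`, width seat `ym3-torus-px12` (gen 5); sequel of ✓ `Prop7CurrentFieldLeibniz` (pointwise B-J2), split at the 400-line rule.  LOCATE «B-J2» (HOME
`ym3-torus-px12/g5/LOCATE-BJ2-px12g5.md`).  WHERE IT SITS: B-J5 = ✓B-J4 `current_pairing_le` at `B := C` + THIS FILE's curl form + B-J3's bound on the principal difference
`MAIN_{κμ} − MAIN_{μκ}` (`≲ ℓ⁻²·CUR` from the covariant tent `J = Q_U^*λ` and ✓B-J1 tent-Gram coercivity) ⇒ J-ROW★ `ℓ²·CUR ≤ C_J·K + C′a²ℓ²·M`.  THEOREMS ONLY (0 `def`, 0 `sorry`);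
`--supports stmt-QuantumFields-19200`, count-neutral.  YM₃ on T³ is a ladder rung (R3), not the Clay problem; nothing here claims J-ROW★, hKg-K, S3, E′, a stub, the crux, d = 4 or
the mass gap.

WHAT IS PROVED (ns `…Theorems.Prop7CurrentFieldCurlSum`).
* `sum_sum_eq_two_mul_sum_lt` (symmetric zero-diagonal double sums), `sum_curlHS_all_eq_two_mul` (all-pairs curl energy `= 2K`), `sum_covDHS_shift_eq` (all-pairs transported `|D_κφ(x+e_μ)|²`
  `= d·M`, torus shift invariance);
* ★★★ `sum_norm_sq_covD_currentField_add_main_sum_le` — the summed B-J2 bound `≤ 8d²J²·(d·M + 2K)`;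
* ★★★ `sum_curlHS_currentField_le` — the curl form above (`curl_U C_{μκ} = (MAIN_{κμ} − MAIN_{μκ}) + (E_{μκ} − E_{κμ})`, `E` the live error of the pointwise file).
HONEST SCOPE.  Bookkeeping over ✓ `Prop7CurrentFieldLeibniz`; crude constants; the principal difference is DISPLAYED for B-J3; no estimate of Bałaban's is asserted.

References: T. Bałaban, CMP 99 (1985) 389–434 [Balaban1985BackgroundPropagators] ((3.3)–(3.4) pp.390–391, (3.8)–(3.9) p.392); CMP 102 (1985) 277–309 [Balaban1985Variational]
((135) p.298, Prop. 7 p.299); CMP 99 (1985) 75–102 [Balaban1985RegularSpaces] ((1.9) p.77).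
-/

set_option autoImplicit false

noncomputable section

open scoped BigOperators Matrix.Norms.L2Operator Matrix

namespace Summit.QuantumFields.YangMills.Theorems.Prop7CurrentFieldCurlSum

open Literature.MathematicalPhysics.QuantumFieldTheory.Balaban1983to89
open B9Eq39Adjoint (R R_def R_add R_sub R_neg covD covDstar curl plaqU curl_swap curl_self)
open B9TorusCalculus (torusT torusT_apply torusT_symm_apply torusT_comm)
open Summit.QuantumFields.YangMills.Theorems.Prop7CovariantCoercivity (sum_norm_sq_add_le)
open Summit.QuantumFields.YangMills.Theorems.Prop7CurrentFieldLeibniz (sum_norm_sq_covD_currentField_add_main_le)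

variable {P : Params} {i : ℕ} {N : ℕ} (U : Fin P.d → Site P i → (Matrix (Fin N) (Fin N) ℂ)ˣ)

/-! ## §1 Double-sum bookkeeping on the torus -/

/-- `Σ_aΣ_b g(a,b) = 2·Σ_{a<b} g(a,b)` for a symmetric `g` with zero diagonal. [folklore] -/
theorem sum_sum_eq_two_mul_sum_lt (g : Fin P.d → Fin P.d → ℝ) (hsymm : ∀ a b, g a b = g b a) (hdiag : ∀ a, g a a = 0) :
    ∑ a : Fin P.d, ∑ b : Fin P.d, g a b = 2 * ∑ a : Fin P.d, ∑ b : Fin P.d, (if a < b then g a b else 0) := by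
  have hsplit : ∀ a b : Fin P.d, g a b = (if a < b then g a b else 0) + (if b < a then g b a else 0) := by
    intro a b
    rcases lt_trichotomy a b with h | h | h
    · rw [if_pos h, if_neg (not_lt.mpr h.le), add_zero]
    · subst h; rw [if_neg (lt_irrefl _), add_zero, hdiag]
    · rw [if_neg (not_lt.mpr h.le), if_pos h, zero_add, hsymm]
  have hswap : ∑ a : Fin P.d, ∑ b : Fin P.d, (if b < a then g b a else 0) = ∑ a : Fin P.d, ∑ b : Fin P.d, (if a < b then g a b else 0) := by
    rw [Finset.sum_comm]
  rw [Finset.sum_congr rfl fun a _ => Finset.sum_congr rfl fun b _ => hsplit a b]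
  simp only [Finset.sum_add_distrib]
  rw [hswap, two_mul]

/-- the all-pairs Hilbert–Schmidt curl energy is twice `K(φ)`: `Σ_xΣ_μΣ_κ|curl_{κμ}|² = 2·Σ_{x,μ<ν}|curl_{μν}|²` (`curl_{νμ} = −curl_{μν}`, `curl_{μμ} = 0`). [folklore] -/
theorem sum_curlHS_all_eq_two_mul (A : Fin P.d → Site P i → Matrix (Fin N) (Fin N) ℂ) :
    ∑ x : Site P i, ∑ μ : Fin P.d, ∑ κ : Fin P.d, ∑ j : Fin N, ∑ k : Fin N, ‖(curl (torusT P i) U A κ μ x) j k‖ ^ 2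
      = 2 * ∑ x : Site P i, ∑ μ : Fin P.d, ∑ ν : Fin P.d, (if μ < ν then
            ∑ j : Fin N, ∑ k : Fin N, ‖(curl (torusT P i) U A μ ν x) j k‖ ^ 2 else 0) := by
  rw [Finset.mul_sum]
  refine Finset.sum_congr rfl fun x _ => ?_
  rw [Finset.sum_comm]
  refine sum_sum_eq_two_mul_sum_lt (P := P) (fun κ μ => ∑ j : Fin N, ∑ k : Fin N, ‖(curl (torusT P i) U A κ μ x) j k‖ ^ 2) ?_ ?_
  · intro a b
    rw [curl_swap]
    simp only [Matrix.neg_apply, norm_neg]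
  · intro a
    simp only [curl_self, Matrix.zero_apply, norm_zero, ne_eq, OfNat.ofNat_ne_zero, not_false_eq_true, zero_pow, Finset.sum_const_zero]

/-- the all-pairs sum of the transported covariant differences is `d·M(φ)` (torus shift invariance). [folklore] -/
theorem sum_covDHS_shift_eq (φ : Site P i → Matrix (Fin N) (Fin N) ℂ) :
    ∑ x : Site P i, ∑ μ : Fin P.d, ∑ κ : Fin P.d, ∑ j : Fin N, ∑ k : Fin N, ‖(covD (torusT P i) U κ φ (x.shift μ)) j k‖ ^ 2
      = P.d * (∑ x : Site P i, ∑ μ : Fin P.d, ∑ j : Fin N, ∑ k : Fin N, ‖(covD (torusT P i) U μ φ x) j k‖ ^ 2) := by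
  rw [Finset.sum_comm]
  have h : ∀ μ : Fin P.d, ∑ x : Site P i, ∑ κ : Fin P.d, ∑ j : Fin N, ∑ k : Fin N, ‖(covD (torusT P i) U κ φ (x.shift μ)) j k‖ ^ 2
      = ∑ x : Site P i, ∑ κ : Fin P.d, ∑ j : Fin N, ∑ k : Fin N, ‖(covD (torusT P i) U κ φ x) j k‖ ^ 2 := by
    intro μ
    exact Equiv.sum_comp (torusT P i μ) (fun y => ∑ κ : Fin P.d, ∑ j : Fin N, ∑ k : Fin N, ‖(covD (torusT P i) U κ φ y) j k‖ ^ 2)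
  rw [Finset.sum_congr rfl fun μ _ => h μ, Finset.sum_const, Finset.card_univ, Fintype.card_fin, nsmul_eq_mul]

/-! ## §2 ★★★ B-J2 summed, and the curl form B-J5 reads -/

/-- ★★★ **B-J2, SUMMED: `Σ_xΣ_μΣ_κ|(D_κ C_μ)(x) + MAIN_{κμ}(x)|²_HS ≤ 8d²J²·(d·M(φ) + 2·K(φ))`** — `M(φ) = Σ|D_Uφ|²_HS`, `K(φ) = Σ_{μ<ν}|curl_U D_Uφ|²_HS`, the letters of
✓p684887 VERBATIM; every error of the Leibniz rule for the current field is booked in the E′ currencies times `J²` (`J := 2a = 2ε₀ℓ⁻²` per summand from PlaqSmall at the member — routeR-w4 g12's reading; B-J5 books `32d²J²(dM+2K)` as `O(e²)K + O(ℓ²)a²M`).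
[cite: Balaban1985BackgroundPropagators, (3.8)-(3.9) p.392; Balaban1985RegularSpaces, (1.9) p.77; Balaban1985Variational, (135) p.298, Prop. 7 p.299] -/
theorem sum_norm_sq_covD_currentField_add_main_sum_le [NeZero N]
    (hU : ∀ (ν : Fin P.d) (x : Site P i), (U ν x : Matrix (Fin N) (Fin N) ℂ) ∈ unitary (Matrix (Fin N) (Fin N) ℂ))
    {J : ℝ} (hJ : ∀ (ν μ : Fin P.d) (z : Site P i), ‖covDstar (torusT P i) U ν (fun w => (plaqU (torusT P i) U ν μ w : Matrix (Fin N) (Fin N) ℂ)) z‖ ≤ J)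
    (φ : Site P i → Matrix (Fin N) (Fin N) ℂ) :
    ∑ x : Site P i, ∑ μ : Fin P.d, ∑ κ : Fin P.d, ∑ j : Fin N, ∑ k : Fin N,
        ‖(covD (torusT P i) U κ ((fun μ' z => ∑ ν : Fin P.d,
        (R ((U ν (z.unshift ν))⁻¹ * plaqU (torusT P i) U ν μ' (z.unshift ν) * U ν (z.unshift ν))
              (R (U ν (z.unshift ν))⁻¹ (R (U μ' (z.unshift ν) * U ν ((z.unshift ν).shift μ')) (φ (((z.unshift ν).shift μ').shift ν))))
          - R (plaqU (torusT P i) U ν μ' z)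
              (R (U ν (z.unshift ν))⁻¹ (R (U μ' (z.unshift ν) * U ν ((z.unshift ν).shift μ')) (φ (((z.unshift ν).shift μ').shift ν)))))) μ) x
          + (∑ ν : Fin P.d,
          (R (U κ x * (plaqU (torusT P i) U ν μ (x.shift κ)
                  * ((U ν ((x.shift κ).unshift ν))⁻¹ * plaqU (torusT P i) U ν μ ((x.shift κ).unshift ν) * U ν ((x.shift κ).unshift ν))⁻¹) * (U κ x)⁻¹)
                (R (U μ x) (φ (x.shift μ)))
            - R (plaqU (torusT P i) U ν μ x * ((U ν (x.unshift ν))⁻¹ * plaqU (torusT P i) U ν μ (x.unshift ν) * U ν (x.unshift ν))⁻¹)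
                (R (U μ x) (φ (x.shift μ)))))) j k‖ ^ 2
      ≤ 8 * (P.d : ℝ) ^ 2 * J ^ 2 * (P.d * (∑ x : Site P i, ∑ μ : Fin P.d, ∑ j : Fin N, ∑ k : Fin N, ‖(covD (torusT P i) U μ φ x) j k‖ ^ 2)
          + 2 * (∑ x : Site P i, ∑ μ : Fin P.d, ∑ ν : Fin P.d, (if μ < ν then
            ∑ j : Fin N, ∑ k : Fin N, ‖(curl (torusT P i) U (fun κ => covD (torusT P i) U κ φ) μ ν x) j k‖ ^ 2 else 0))) := by
  rw [← sum_covDHS_shift_eq U φ, ← sum_curlHS_all_eq_two_mul U (fun κ => covD (torusT P i) U κ φ), ← Finset.sum_add_distrib, Finset.mul_sum]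
  refine Finset.sum_le_sum fun x _ => ?_
  rw [← Finset.sum_add_distrib, Finset.mul_sum]
  refine Finset.sum_le_sum fun μ _ => ?_
  rw [← Finset.sum_add_distrib, Finset.mul_sum]
  refine Finset.sum_le_sum fun κ _ => ?_
  exact sum_norm_sq_covD_currentField_add_main_le U hU hJ φ μ κ x

/-- ★★★ **B-J2, CURL FORM (what B-J5 reads with `B := C` in ✓ `current_pairing_le`)**: `curl_U C_{μκ}(x) = (MAIN_{κμ} − MAIN_{μκ})(x) + live`, hence
`Σ_{x,μ<κ}|curl_U C_{μκ}(x)|²_HS ≤ 2·Σ_{x,μ<κ}|(MAIN_{κμ} − MAIN_{μκ})(x)|²_HS + 32·d²J²·(d·M(φ) + 2·K(φ))` — the curl energy of the current field is the energy of ONE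
principal difference (B-J3's input: covariant tent `J = Q_U^*λ` + ✓B-J1 tent-Gram ⇒ `≲ ℓ⁻²·CUR`) plus errors in the E′ currencies.
[cite: Balaban1985BackgroundPropagators, (3.8)-(3.9) p.392; Balaban1985Variational, (135) p.298, Prop. 7 p.299] -/
theorem sum_curlHS_currentField_le [NeZero N]
    (hU : ∀ (ν : Fin P.d) (x : Site P i), (U ν x : Matrix (Fin N) (Fin N) ℂ) ∈ unitary (Matrix (Fin N) (Fin N) ℂ))
    {J : ℝ} (hJ : ∀ (ν μ : Fin P.d) (z : Site P i), ‖covDstar (torusT P i) U ν (fun w => (plaqU (torusT P i) U ν μ w : Matrix (Fin N) (Fin N) ℂ)) z‖ ≤ J)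
    (φ : Site P i → Matrix (Fin N) (Fin N) ℂ) :
    ∑ x : Site P i, ∑ μ : Fin P.d, ∑ κ : Fin P.d, (if μ < κ then
        ∑ j : Fin N, ∑ k : Fin N, ‖(curl (torusT P i) U (fun μ' z => ∑ ν : Fin P.d,
        (R ((U ν (z.unshift ν))⁻¹ * plaqU (torusT P i) U ν μ' (z.unshift ν) * U ν (z.unshift ν))
              (R (U ν (z.unshift ν))⁻¹ (R (U μ' (z.unshift ν) * U ν ((z.unshift ν).shift μ')) (φ (((z.unshift ν).shift μ').shift ν))))
          - R (plaqU (torusT P i) U ν μ' z)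
              (R (U ν (z.unshift ν))⁻¹ (R (U μ' (z.unshift ν) * U ν ((z.unshift ν).shift μ')) (φ (((z.unshift ν).shift μ').shift ν)))))) μ κ x) j k‖ ^ 2 else 0)
      ≤ 2 * ∑ x : Site P i, ∑ μ : Fin P.d, ∑ κ : Fin P.d, (if μ < κ then
          ∑ j : Fin N, ∑ k : Fin N, ‖((∑ ν : Fin P.d,
          (R (U κ x * (plaqU (torusT P i) U ν μ (x.shift κ)
                  * ((U ν ((x.shift κ).unshift ν))⁻¹ * plaqU (torusT P i) U ν μ ((x.shift κ).unshift ν) * U ν ((x.shift κ).unshift ν))⁻¹) * (U κ x)⁻¹)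
                (R (U μ x) (φ (x.shift μ)))
            - R (plaqU (torusT P i) U ν μ x * ((U ν (x.unshift ν))⁻¹ * plaqU (torusT P i) U ν μ (x.unshift ν) * U ν (x.unshift ν))⁻¹)
                (R (U μ x) (φ (x.shift μ)))))
            - (∑ ν : Fin P.d,
          (R (U μ x * (plaqU (torusT P i) U ν κ (x.shift μ)
                  * ((U ν ((x.shift μ).unshift ν))⁻¹ * plaqU (torusT P i) U ν κ ((x.shift μ).unshift ν) * U ν ((x.shift μ).unshift ν))⁻¹) * (U μ x)⁻¹)
                (R (U κ x) (φ (x.shift κ)))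
            - R (plaqU (torusT P i) U ν κ x * ((U ν (x.unshift ν))⁻¹ * plaqU (torusT P i) U ν κ (x.unshift ν) * U ν (x.unshift ν))⁻¹)
                (R (U κ x) (φ (x.shift κ)))))) j k‖ ^ 2 else 0)
        + 32 * (P.d : ℝ) ^ 2 * J ^ 2 * (P.d * (∑ x : Site P i, ∑ μ : Fin P.d, ∑ j : Fin N, ∑ k : Fin N, ‖(covD (torusT P i) U μ φ x) j k‖ ^ 2)
          + 2 * (∑ x : Site P i, ∑ μ : Fin P.d, ∑ ν : Fin P.d, (if μ < ν then
            ∑ j : Fin N, ∑ k : Fin N, ‖(curl (torusT P i) U (fun κ => covD (torusT P i) U κ φ) μ ν x) j k‖ ^ 2 else 0))) := by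
  have hsum := sum_norm_sq_covD_currentField_add_main_sum_le U hU hJ φ
  -- letters: `E κ μ x` = the live error of the Leibniz rule, `Mn κ μ x` = MAIN
  set E : Fin P.d → Fin P.d → Site P i → Matrix (Fin N) (Fin N) ℂ := fun κ μ x =>
    covD (torusT P i) U κ ((fun μ' z => ∑ ν : Fin P.d,
        (R ((U ν (z.unshift ν))⁻¹ * plaqU (torusT P i) U ν μ' (z.unshift ν) * U ν (z.unshift ν))
              (R (U ν (z.unshift ν))⁻¹ (R (U μ' (z.unshift ν) * U ν ((z.unshift ν).shift μ')) (φ (((z.unshift ν).shift μ').shift ν))))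
          - R (plaqU (torusT P i) U ν μ' z)
              (R (U ν (z.unshift ν))⁻¹ (R (U μ' (z.unshift ν) * U ν ((z.unshift ν).shift μ')) (φ (((z.unshift ν).shift μ').shift ν)))))) μ) x + (∑ ν : Fin P.d,
          (R (U κ x * (plaqU (torusT P i) U ν μ (x.shift κ)
                  * ((U ν ((x.shift κ).unshift ν))⁻¹ * plaqU (torusT P i) U ν μ ((x.shift κ).unshift ν) * U ν ((x.shift κ).unshift ν))⁻¹) * (U κ x)⁻¹)
                (R (U μ x) (φ (x.shift μ)))
            - R (plaqU (torusT P i) U ν μ x * ((U ν (x.unshift ν))⁻¹ * plaqU (torusT P i) U ν μ (x.unshift ν) * U ν (x.unshift ν))⁻¹)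
                (R (U μ x) (φ (x.shift μ))))) with hE
  set Mn : Fin P.d → Fin P.d → Site P i → Matrix (Fin N) (Fin N) ℂ := fun κ μ x => (∑ ν : Fin P.d,
          (R (U κ x * (plaqU (torusT P i) U ν μ (x.shift κ)
                  * ((U ν ((x.shift κ).unshift ν))⁻¹ * plaqU (torusT P i) U ν μ ((x.shift κ).unshift ν) * U ν ((x.shift κ).unshift ν))⁻¹) * (U κ x)⁻¹)
                (R (U μ x) (φ (x.shift μ)))
            - R (plaqU (torusT P i) U ν μ x * ((U ν (x.unshift ν))⁻¹ * plaqU (torusT P i) U ν μ (x.unshift ν) * U ν (x.unshift ν))⁻¹)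
                (R (U μ x) (φ (x.shift μ))))) with hMn
  have hcurl : ∀ (μ κ : Fin P.d) (x : Site P i), curl (torusT P i) U (fun μ' z => ∑ ν : Fin P.d,
        (R ((U ν (z.unshift ν))⁻¹ * plaqU (torusT P i) U ν μ' (z.unshift ν) * U ν (z.unshift ν))
              (R (U ν (z.unshift ν))⁻¹ (R (U μ' (z.unshift ν) * U ν ((z.unshift ν).shift μ')) (φ (((z.unshift ν).shift μ').shift ν))))
          - R (plaqU (torusT P i) U ν μ' z)
              (R (U ν (z.unshift ν))⁻¹ (R (U μ' (z.unshift ν) * U ν ((z.unshift ν).shift μ')) (φ (((z.unshift ν).shift μ').shift ν)))))) μ κ x = (Mn κ μ x - Mn μ κ x) + (E μ κ x - E κ μ x) := by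
    intro μ κ x
    simp only [curl, hE, hMn]
    abel
  have hpt : ∀ (μ κ : Fin P.d) (x : Site P i), ∑ j : Fin N, ∑ k : Fin N, ‖(curl (torusT P i) U (fun μ' z => ∑ ν : Fin P.d,
        (R ((U ν (z.unshift ν))⁻¹ * plaqU (torusT P i) U ν μ' (z.unshift ν) * U ν (z.unshift ν))
              (R (U ν (z.unshift ν))⁻¹ (R (U μ' (z.unshift ν) * U ν ((z.unshift ν).shift μ')) (φ (((z.unshift ν).shift μ').shift ν))))
          - R (plaqU (torusT P i) U ν μ' z)
              (R (U ν (z.unshift ν))⁻¹ (R (U μ' (z.unshift ν) * U ν ((z.unshift ν).shift μ')) (φ (((z.unshift ν).shift μ').shift ν)))))) μ κ x) j k‖ ^ 2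
      ≤ 2 * ∑ j : Fin N, ∑ k : Fin N, ‖(Mn κ μ x - Mn μ κ x) j k‖ ^ 2
        + (4 * ∑ j : Fin N, ∑ k : Fin N, ‖(E μ κ x) j k‖ ^ 2 + 4 * ∑ j : Fin N, ∑ k : Fin N, ‖(E κ μ x) j k‖ ^ 2) := by
    intro μ κ x
    rw [hcurl]
    refine (sum_norm_sq_add_le _ _).trans ?_
    have h2 := sum_norm_sq_add_le (E μ κ x) (-E κ μ x)
    have hneg : ∑ j : Fin N, ∑ k : Fin N, ‖(-E κ μ x) j k‖ ^ 2 = ∑ j : Fin N, ∑ k : Fin N, ‖(E κ μ x) j k‖ ^ 2 := by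
      simp only [Matrix.neg_apply, norm_neg]
    rw [← sub_eq_add_neg, hneg] at h2
    linarith
  -- sum the pointwise bound over `μ < κ`; the `E`-terms over ordered pairs are dominated by the all-pairs sum
  have hEsum : ∑ x : Site P i, ∑ μ : Fin P.d, ∑ κ : Fin P.d, (if μ < κ then
        (4 * ∑ j : Fin N, ∑ k : Fin N, ‖(E μ κ x) j k‖ ^ 2 + 4 * ∑ j : Fin N, ∑ k : Fin N, ‖(E κ μ x) j k‖ ^ 2) else 0)
      ≤ 4 * ∑ x : Site P i, ∑ μ : Fin P.d, ∑ κ : Fin P.d, ∑ j : Fin N, ∑ k : Fin N, ‖(E κ μ x) j k‖ ^ 2 := by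
    rw [Finset.mul_sum]
    refine Finset.sum_le_sum fun x _ => ?_
    have hnn : ∀ a b : Fin P.d, 0 ≤ ∑ j : Fin N, ∑ k : Fin N, ‖(E a b x) j k‖ ^ 2 := fun a b =>
      Finset.sum_nonneg fun _ _ => Finset.sum_nonneg fun _ _ => sq_nonneg _
    have h1 : ∑ μ : Fin P.d, ∑ κ : Fin P.d, (if μ < κ then 4 * ∑ j : Fin N, ∑ k : Fin N, ‖(E μ κ x) j k‖ ^ 2 else 0)
        ≤ ∑ μ : Fin P.d, ∑ κ : Fin P.d, (if μ < κ then 4 * ∑ j : Fin N, ∑ k : Fin N, ‖(E μ κ x) j k‖ ^ 2 else 0)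
          + ∑ μ : Fin P.d, ∑ κ : Fin P.d, (if κ < μ then 4 * ∑ j : Fin N, ∑ k : Fin N, ‖(E μ κ x) j k‖ ^ 2 else 0) := by
      have : 0 ≤ ∑ μ : Fin P.d, ∑ κ : Fin P.d, (if κ < μ then 4 * ∑ j : Fin N, ∑ k : Fin N, ‖(E μ κ x) j k‖ ^ 2 else 0) :=
        Finset.sum_nonneg fun μ _ => Finset.sum_nonneg fun κ _ => by split_ifs <;> [exact mul_nonneg (by norm_num) (hnn μ κ); exact le_rfl]
      linarith
    have hswapE : ∑ μ : Fin P.d, ∑ κ : Fin P.d, (if μ < κ then 4 * ∑ j : Fin N, ∑ k : Fin N, ‖(E κ μ x) j k‖ ^ 2 else 0)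
        = ∑ μ : Fin P.d, ∑ κ : Fin P.d, (if κ < μ then 4 * ∑ j : Fin N, ∑ k : Fin N, ‖(E μ κ x) j k‖ ^ 2 else 0) := by
      rw [Finset.sum_comm]
    have hall : ∑ μ : Fin P.d, ∑ κ : Fin P.d, (if μ < κ then 4 * ∑ j : Fin N, ∑ k : Fin N, ‖(E μ κ x) j k‖ ^ 2 else 0)
          + ∑ μ : Fin P.d, ∑ κ : Fin P.d, (if κ < μ then 4 * ∑ j : Fin N, ∑ k : Fin N, ‖(E μ κ x) j k‖ ^ 2 else 0)
        ≤ 4 * ∑ μ : Fin P.d, ∑ κ : Fin P.d, ∑ j : Fin N, ∑ k : Fin N, ‖(E κ μ x) j k‖ ^ 2 := by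
      rw [Finset.sum_comm (f := fun μ κ => ∑ j : Fin N, ∑ k : Fin N, ‖(E κ μ x) j k‖ ^ 2), ← Finset.sum_add_distrib, Finset.mul_sum]
      refine Finset.sum_le_sum fun μ _ => ?_
      rw [← Finset.sum_add_distrib, Finset.mul_sum]
      refine Finset.sum_le_sum fun κ _ => ?_
      rcases lt_trichotomy μ κ with h | h | h
      · rw [if_pos h, if_neg (not_lt.mpr h.le), add_zero]
      · subst h; rw [if_neg (lt_irrefl _), add_zero]; exact mul_nonneg (by norm_num) (hnn _ _)
      · rw [if_neg (not_lt.mpr h.le), if_pos h, zero_add]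
    have hsplit : ∑ μ : Fin P.d, ∑ κ : Fin P.d, (if μ < κ then
          (4 * ∑ j : Fin N, ∑ k : Fin N, ‖(E μ κ x) j k‖ ^ 2 + 4 * ∑ j : Fin N, ∑ k : Fin N, ‖(E κ μ x) j k‖ ^ 2) else 0)
        = ∑ μ : Fin P.d, ∑ κ : Fin P.d, (if μ < κ then 4 * ∑ j : Fin N, ∑ k : Fin N, ‖(E μ κ x) j k‖ ^ 2 else 0)
          + ∑ μ : Fin P.d, ∑ κ : Fin P.d, (if μ < κ then 4 * ∑ j : Fin N, ∑ k : Fin N, ‖(E κ μ x) j k‖ ^ 2 else 0) := by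
      rw [← Finset.sum_add_distrib]
      refine Finset.sum_congr rfl fun μ _ => ?_
      rw [← Finset.sum_add_distrib]
      refine Finset.sum_congr rfl fun κ _ => ?_
      split_ifs <;> simp
    rw [hsplit, hswapE]
    exact hall
  -- assemble
  have hL : ∑ x : Site P i, ∑ μ : Fin P.d, ∑ κ : Fin P.d, (if μ < κ then
        ∑ j : Fin N, ∑ k : Fin N, ‖(curl (torusT P i) U (fun μ' z => ∑ ν : Fin P.d,
        (R ((U ν (z.unshift ν))⁻¹ * plaqU (torusT P i) U ν μ' (z.unshift ν) * U ν (z.unshift ν))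
              (R (U ν (z.unshift ν))⁻¹ (R (U μ' (z.unshift ν) * U ν ((z.unshift ν).shift μ')) (φ (((z.unshift ν).shift μ').shift ν))))
          - R (plaqU (torusT P i) U ν μ' z)
              (R (U ν (z.unshift ν))⁻¹ (R (U μ' (z.unshift ν) * U ν ((z.unshift ν).shift μ')) (φ (((z.unshift ν).shift μ').shift ν)))))) μ κ x) j k‖ ^ 2 else 0)
      ≤ ∑ x : Site P i, ∑ μ : Fin P.d, ∑ κ : Fin P.d, (if μ < κ then
          2 * ∑ j : Fin N, ∑ k : Fin N, ‖(Mn κ μ x - Mn μ κ x) j k‖ ^ 2 else 0)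
        + ∑ x : Site P i, ∑ μ : Fin P.d, ∑ κ : Fin P.d, (if μ < κ then
          (4 * ∑ j : Fin N, ∑ k : Fin N, ‖(E μ κ x) j k‖ ^ 2 + 4 * ∑ j : Fin N, ∑ k : Fin N, ‖(E κ μ x) j k‖ ^ 2) else 0) := by
    rw [← Finset.sum_add_distrib]
    refine Finset.sum_le_sum fun x _ => ?_
    rw [← Finset.sum_add_distrib]
    refine Finset.sum_le_sum fun μ _ => ?_
    rw [← Finset.sum_add_distrib]
    refine Finset.sum_le_sum fun κ _ => ?_
    split_ifs
    · exact hpt μ κ x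
    · simp
  have hM2 : ∑ x : Site P i, ∑ μ : Fin P.d, ∑ κ : Fin P.d, (if μ < κ then
          2 * ∑ j : Fin N, ∑ k : Fin N, ‖(Mn κ μ x - Mn μ κ x) j k‖ ^ 2 else 0)
      = 2 * ∑ x : Site P i, ∑ μ : Fin P.d, ∑ κ : Fin P.d, (if μ < κ then
          ∑ j : Fin N, ∑ k : Fin N, ‖(Mn κ μ x - Mn μ κ x) j k‖ ^ 2 else 0) := by
    rw [Finset.mul_sum]
    refine Finset.sum_congr rfl fun x _ => ?_
    rw [Finset.mul_sum]
    refine Finset.sum_congr rfl fun μ _ => ?_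
    rw [Finset.mul_sum]
    refine Finset.sum_congr rfl fun κ _ => ?_
    split_ifs <;> simp
  rw [hM2] at hL
  have hEs : ∑ x : Site P i, ∑ μ : Fin P.d, ∑ κ : Fin P.d, ∑ j : Fin N, ∑ k : Fin N, ‖(E κ μ x) j k‖ ^ 2
      ≤ 8 * (P.d : ℝ) ^ 2 * J ^ 2 * (P.d * (∑ x : Site P i, ∑ μ : Fin P.d, ∑ j : Fin N, ∑ k : Fin N, ‖(covD (torusT P i) U μ φ x) j k‖ ^ 2)
          + 2 * (∑ x : Site P i, ∑ μ : Fin P.d, ∑ ν : Fin P.d, (if μ < ν then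
            ∑ j : Fin N, ∑ k : Fin N, ‖(curl (torusT P i) U (fun κ => covD (torusT P i) U κ φ) μ ν x) j k‖ ^ 2 else 0))) := by
    simpa only [hE] using hsum
  simp only [hMn] at hL
  linarith [hL, hEsum, hEs]

end Summit.QuantumFields.YangMills.Theorems.Prop7CurrentFieldCurlSum

end
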